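import Summits.ResolutionOfSingularities.ResolutionOfSingularities.Theorems.StallVertexLineTurn
import HarnessLib

/-!
# StallVertexRegime — decomp-res node «StallVertex» (lens-5 g20/g21 rev 6), add-on tree file 14 of the node

Content VERBATIM from the decomp-res lens-5 file `HOME/decomp-res-lens-5/g21/StallVertex.lean` rev 6 (pin 95ed6f6f,
3 344 l; rev 6 SUPERSEDES rev 5 5d7e6b95,
rev 4 74ef32c0 and rev 3 549891b7 as landing source — pure insertions, all earlier statements byte-identical
(critic machine diffs); HOME = run/shared/lean/pub/decomp-res).
The rev-0/1/2 sections are ALREADY in the tree (`StallVertexForms` / `Kernels` / `Walk` / `Classes` / `Clean` /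
`Rigid` / `Lines` / `RigidClasses` / `MaxContactCutStallVertex`,
writer g7); the add-on files carry ONLY the declarations NEW in rev 3 / 4 / 5 / 6.  Critic: CRITIC-LEDGER rows 142c
(rev 3: the old-letter law, CLEARED 2026-08-30T21:45:00Z),
142d (rev 4: the general carried-line law + line dichotomy, DECIDED +1, 22:09:45Z), 142e (rev 5: the turn law,
22:25:58Z), 142f (rev 6: THE EVENT-FREE LEAF IS EMPTY +
THE MONOMIAL REGIME, DECIDED +1 for (S) as a whole, 22:52:49Z) — landing orders INBOX :362 / :396 / :429 (2) /
:471.  Landed by decomp-res writer g8 as `StallVertexCarry`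
(§1d–§1e), `StallVertexOldLetter` (§1g + §3d–§3e), `StallVertexLineTurn` (§3f–§3g),
`StallVertexLetterClasses` (§4d–§4e classes and exact re-locations),
`StallVertexRegime` (§1i the monomial carry law + §3h a derivative is always carried / the monomial step),
`StallVertexStraightClasses` (§4f + §4g classes and exact
re-locations) and the wiring file `MaxContactCutStallVertexEvents` (every new `closes_…` /
`defectWalksDeep_iff_…` BY NAME on `MaxContactCut.DefectWalksDeep`).
All `--supports stmt-ResolutionOfSingularities-31770`.  Every file of the node is in the Theses cone (the lens
imports the in-cone `DifferentialShade`), so the located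
residual is booked on the route by RE-LOCATING the existing aside 28122 `CFNoSkewJointTailsDeep` to
`StallVertex.NoMonomialRegimeSkewStalledTailsDeep` (EXACT,
hypothesis-free chain skew ↔ vertexBound ↔ rigid ↔ lineFree ↔ letterFree ↔ eventFree ↔ straight ↔
monomialRegime: `skew_iff_monomialRegime`) — one aside on this
column, superseding the straight / event-free re-locations (critic row 142f: «file only the newest, exactly one
aside on this column; decided cells not filed»).

§1i (rev 6, `section Algebra`) THE MONOMIAL CARRY LAW `carry_monomial_of_clean` (through a clean move a monomial
cone `ρ·u^S` stays a monomial: chart letter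
re-booked with exponent `d − a`, translated letters lost, kept letters kept); §3h (rev 6, `section Walk`) A
DERIVATIVE IS ALWAYS CARRIED — `muP_zero_ne_top` /
**`muP_ne_top`** (`μ_P < ∞` at every time of a root walk: else the top ideal is `⊥` and the origin is not an
isolated top point) — and THE MONOMIAL STEP
**`monomial_step`** (explicit one-step dynamics of a young monomial cone under a clean stalled move).  PROVED, 0
sorry.  Imports `StallVertexLineTurn`.

[WRITER NOTE (decomp-res writer g8): file split only; namespace, opens, section variables and every declaration
exactly as in the lens (global `set_option` dropped; the lens's `set_option maxHeartbeats … in` lines kept; the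
lens's private copy `flat_monomial'` of the landed
`Literature.AlgebraicGeometry.Resolution.PointBlowup.flat_monomial` is dropped and cited by its full name).]

(Sources: KawanoueMatsuki2016 Prop. 4 (2), §4.1; Kawanoue2007 Lemma 2.2.1.2; BierstoneGrigorievMilmanWlodarczyk2011
Def. 3.1.3; Hauser2010; HauserPerlega2024; Moh1987; CossartPiltant2008; Giraud1975; Hironaka1964; ZariskiSamuelII Ch. VIII §2.)
-/

noncomputable section

open MvPolynomial Finset
open Literature.AlgebraicGeometry.Resolution
open Literature.AlgebraicGeometry.Resolution.Hauser2010
open Literature.AlgebraicGeometry.Resolution.HauserPerlega2024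
open Literature.Barriers.ResolutionOfSingularities
open Literature.AlgebraicGeometry.Resolution.PointBlowup
open Summit.ResolutionOfSingularities.ResolutionOfSingularities.Theses
open Summit.ResolutionOfSingularities.ResolutionOfSingularities.Theorems.TightDefectClasses
open Summit.ResolutionOfSingularities.ResolutionOfSingularities.Theorems.ProximityCut
open Summit.ResolutionOfSingularities.ResolutionOfSingularities.Theorems.ExitLaw
open Summit.ResolutionOfSingularities.ResolutionOfSingularities.Theorems.DifferentialShade

namespace Summit.ResolutionOfSingularities.ResolutionOfSingularities.Theorems.StallVertex

section Algebra

variable {σ : Type*} {K : Type*} [Field K] [Fintype σ] [DecidableEq σ]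

/-! ### §1i THE MONOMIAL CARRY LAW: through a clean move a monomial cone `ρ·u^S` stays a monomial (the algebra of the
MONOMIAL REGIME, rev 6) -/

/-- **THE MONOMIAL CARRY LAW (algebraic, one clean move).**  Let `G` have order `d` and initial form THE MONOMIAL
`ρ·u^S`, and let the move `(j, b)` (`b_j = 0`, level `a ≤ d`) be CLEAN for `G`.  Then the transform
`G' = translate b (chartTransform a j G)` has order `(d − a) + |S♭|` and initial form THE MONOMIAL
`(ρ·∏_{bᵢ ≠ 0} bᵢ^{Sᵢ}) · u_j^{d−a} · u^{S♭}` with `S♭ = (S ∖ j)|_{bᵢ = 0}`: the chart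
letter is RE-BOOKED with exponent
exactly `d − a`, the translated letters are LOST (their powers become units at the new point), the untranslated letters
are KEPT with their exponents.  (The `γ = 0` reading of the carry law `carry_of_clean`, freed of its line.) [new] [folklore] -/
theorem carry_monomial_of_clean [DecidableEq K] (b : σ → K) {j : σ} (hbj : b j = 0) {a d : ℕ} (had : a ≤ d)
    {G : MvPolynomial σ K} (hd : ordZero G = d) (S : σ →₀ ℕ) {ρ : K} (hρ : ρ ≠ 0)
    (hG : homogeneousComponent d G = monomial S ρ) (hcl : CleanMove d j b G) :
    ordZero (PointBlowup.translate b (chartTransform a j G)) =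
        ((d - a + ((S.erase j).filter (fun i => b i = 0)).degree : ℕ) : ℕ∞) ∧
      homogeneousComponent (d - a + ((S.erase j).filter (fun i => b i = 0)).degree)
          (PointBlowup.translate b (chartTransform a j G)) =
        monomial (Finsupp.single j (d - a) + (S.erase j).filter (fun i => b i = 0))
          (ρ * ∏ i ∈ univ.filter (fun i => b i ≠ 0), b i ^ ((S.erase j) i)) := by
  classical
  obtain ⟨U, hUdef⟩ : ∃ U : MvPolynomial σ K,
      U = ∏ i ∈ univ.filter (fun i => b i ≠ 0), (X i + C (b i) : MvPolynomial σ K) ^ ((S.erase j) i) := ⟨_, rfl⟩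
  obtain ⟨sf, hsfdef⟩ : ∃ sf : σ →₀ ℕ, sf = (S.erase j).filter (fun i => b i = 0) := ⟨_, rfl⟩
  rw [← hsfdef]
  have hu0 : (∏ i ∈ univ.filter (fun i => b i ≠ 0), b i ^ ((S.erase j) i)) ≠ 0 :=
    Finset.prod_ne_zero_iff.mpr fun i hi => pow_ne_zero _ (Finset.mem_filter.mp hi).2
  have hUc : constantCoeff U = ∏ i ∈ univ.filter (fun i => b i ≠ 0), b i ^ ((S.erase j) i) := by
    rw [hUdef]; exact constantCoeff_prod_X_add_C_pow b _ _
  have hU0 : ordZero U = 0 := by rw [ordZero_eq_zero_iff, hUc]; exact hu0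
  -- the direction form of a monomial cone: the kept monomial times a unit
  have hdir : dirForm d j b G = monomial sf ρ * U := by
    rw [dirForm_eq_dehom, hG]
    unfold dehom
    rw [Literature.AlgebraicGeometry.Resolution.PointBlowup.flat_monomial, WeightedBlowup.translate_monomial, prod_X_add_C_pow_split, ← hUdef, ← hsfdef, ← mul_assoc,
      C_mul_monomial, mul_one]
  have hn : ordZero (dirForm d j b G) = ((sf.degree : ℕ) : ℕ∞) := by
    rw [hdir, ordZero_mul, ordZero_monomial _ hρ, hU0, add_zero]
  have hsfhom : (monomial sf ρ : MvPolynomial σ K).IsHomogeneous sf.degree := isHomogeneous_monomial _ rfl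
  have hin : homogeneousComponent sf.degree (dirForm d j b G) =
      monomial sf (ρ * ∏ i ∈ univ.filter (fun i => b i ≠ 0), b i ^ ((S.erase j) i)) := by
    rw [hdir, show sf.degree = sf.degree + 0 from rfl, homogeneousComponent_mul_of_isHomogeneous' hsfhom,
      homogeneousComponent_zero, ← constantCoeff_eq, hUc, mul_comm ((monomial sf) ρ) (C _), C_mul_monomial, mul_comm ρ]
  refine ⟨ordZero_move_of_clean b hbj had hd hn hcl, ?_⟩
  rw [initialForm_move_of_clean b hbj had hd hn hcl, hin, X_pow_eq_monomial, monomial_mul, one_mul]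

end Algebra

section Walk

variable {K : Type} [Field K] [DecidableEq K]

variable {q : ℕ} {s₀ : State (Fin 3) K}

/-! ### §3h A DERIVATIVE IS ALWAYS CARRIED (`μ_P < ∞` at every time of a root walk) and THE MONOMIAL STEP (rev 6) -/

/-- **At the root of a forced walk some derivative `∂_J F`, `0 < |J| < q`, is non-zero** — otherwise every Hasse–Schmidt
derivative `D^{(d)} F` (`d ≠ 0`, `|d| < q`) vanishes, the top ideal `J_F` is `⊥`, and the origin is NOT an isolated
top point, against `W.isolated 0` — hence `μ_P(ifp W 0) < ∞`: the carried family is non-empty and non-zero.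
[folklore: BierstoneGrigorievMilmanWlodarczyk2011 Def. 3.1.3 (isolation); Kawanoue2007 Lemma 2.2.1.2 (derivative
indices)] [folklore] -/
theorem muP_zero_ne_top (W : ForcedWalk q s₀) : (ifp W 0).muP q ≠ ⊤ := by
  classical
  have hne : (IFPState.derivIndices q s₀.F).Nonempty := by
    by_contra h0
    rw [Finset.not_nonempty_iff_eq_empty] at h0
    obtain ⟨N, g, hg0, hg⟩ := W.isolated 0
    have hF : (W.st 0).F = s₀.F := by rw [W.st_zero]
    have hbot : topIdeal q (W.st 0).F = ⊥ := by
      rw [hF]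
      refine Ideal.span_eq_bot.mpr ?_
      rintro _ ⟨d, ⟨hd0, hdq⟩, rfl⟩
      show Literature.AlgebraicGeometry.Resolution.hasseDeriv K d s₀.F = 0
      by_contra hne
      obtain ⟨β, hβ⟩ := MvPolynomial.ne_zero_iff.mp hne
      rw [coeff_hasseDeriv] at hβ
      have hc : coeff (d + β) s₀.F ≠ 0 := fun h => hβ (by rw [h, mul_zero])
      have hdeg : 0 < d.degree := by
        rw [pos_iff_ne_zero]; exact fun h => hd0 ((Finsupp.degree_eq_zero_iff d).mp h)
      have hmem : d ∈ IFPState.derivIndices q s₀.F := by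
        unfold IFPState.derivIndices
        rw [Finset.mem_filter, Finset.mem_biUnion]
        refine ⟨⟨d + β, mem_support_iff.mpr hc, Finset.mem_Iic.mpr le_self_add⟩, hdeg, hdq, ?_⟩
        rw [PointBlowup.hasseDeriv_eq_hasseDeriv]; exact hne
      rw [h0] at hmem
      exact Finset.notMem_empty _ hmem
    have h1 := hg 0
    rw [hbot, Ideal.mem_bot] at h1
    rcases mul_eq_zero.mp h1 with h | h
    · exact hg0 (by rw [h, map_zero])
    · exact pow_ne_zero N (X_ne_zero (0 : Fin 3)) h
  obtain ⟨J, hJ⟩ := hne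
  have hJ' : J ∈ (ifp W 0).idx := by rw [idx_ifp]; exact hJ
  have hgen : (ifp W 0).gen J ≠ 0 := by
    unfold IFPState.derivIndices at hJ
    exact (Finset.mem_filter.mp hJ).2.2.2
  obtain ⟨n, hn⟩ := exists_ordZero_eq_natCast hgen
  intro htop
  have hle : (ifp W 0).muP q ≤ levelRatio (ordZero ((ifp W 0).gen J)) (q - J.degree) := Finset.inf_le hJ'
  rw [htop, hn, levelRatio_natCast, top_le_iff] at hle
  exact WithTop.coe_ne_top hle

/-- **A DERIVATIVE IS ALWAYS CARRIED: `μ_P(ifp W t) < ∞` at EVERY time of a forced walk from a root** (kernel, every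
`q`, every field): non-empty and non-zero at the root (`muP_zero_ne_top`), and a non-zero carried derivative stays
non-zero (`muP_ne_top_succ`).  The «unit already resolved, `μ_P = ∞`» alternative of every located residual is
VACUOUS. [folklore] -/
theorem muP_ne_top {p e : ℕ} (hp : p.Prime) [CharP K p] {s₀ : State (Fin 3) K} (hs : IsRoot (p ^ e) s₀)
    (W : ForcedWalk (p ^ e) s₀) (t : ℕ) : (ifp W t).muP (p ^ e) ≠ ⊤ :=
  muP_ne_top_of_le hp hs W (muP_zero_ne_top W) (Nat.zero_le t)

/-- **THE MONOMIAL STEP (walk law of the monomial regime).**  At a stalled move `t` of a root walk that is clean for the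
minimisers, let `J₀` be a `μ_P`-minimiser whose tangent cone is THE MONOMIAL `ρ·u^S` (`|S| = d₀ = ord₀
g₀`, level `a₀`).
Then `a₀ ≤ d₀`, and at `t + 1` the index `J₀` is again a minimiser (stall rigidity) whose cone is THE MONOMIAL
`ρ'·u^{S'}`, `S' = (d₀ − a₀)·e_{j_t} + (S ∖ j_t)|_{b_t = 0}`, `ρ' = ρ·∏_{b_t i ≠ 0} (b_t
i)^{S_i}`: the chart letter is
re-booked with exponent `d₀ − a₀ = a₀(μ_P − 1)`, translated letters are lost, kept letters keep their exponents, and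
`ord₀ g₀' = (d₀ − a₀) + |S'| − (d₀ − a₀) = d₀ − a₀ + (kept mass)`. [new] [folklore] -/
theorem monomial_step {p e : ℕ} (hp : p.Prime) [CharP K p] {s₀ : State (Fin 3) K} (hs : IsRoot (p ^ e) s₀)
    (W : ForcedWalk (p ^ e) s₀) (t : ℕ)
    (hst : (ifp W (t + 1)).muTilde (p ^ e) = (ifp W t).muTilde (p ^ e)) (hcl : CleanAt W t)
    {J₀ : Fin 3 →₀ ℕ} (hJ₀ : J₀ ∈ (ifp W t).idx)
    (hμ : (ifp W t).muP (p ^ e) = levelRatio (ordZero ((ifp W t).gen J₀)) (p ^ e - J₀.degree))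
    (S : Fin 3 →₀ ℕ) {ρ : K} (hρ : ρ ≠ 0) (hd₀ : ordZero ((ifp W t).gen J₀) = ((S.degree : ℕ) : ℕ∞))
    (hG : homogeneousComponent S.degree ((ifp W t).gen J₀) = monomial S ρ) :
    J₀ ∈ (ifp W (t + 1)).idx ∧
      (ifp W (t + 1)).muP (p ^ e) = levelRatio (ordZero ((ifp W (t + 1)).gen J₀)) (p ^ e - J₀.degree) ∧
      p ^ e - J₀.degree ≤ S.degree ∧
      ordZero ((ifp W (t + 1)).gen J₀) =
        ((S.degree - (p ^ e - J₀.degree) + ((S.erase (W.j t)).filter (fun i => W.b t i = 0)).degree : ℕ) : ℕ∞) ∧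
      homogeneousComponent (S.degree - (p ^ e - J₀.degree) + ((S.erase (W.j t)).filter (fun i => W.b t i = 0)).degree)
          ((ifp W (t + 1)).gen J₀) =
        monomial (Finsupp.single (W.j t) (S.degree - (p ^ e - J₀.degree)) +
            (S.erase (W.j t)).filter (fun i => W.b t i = 0))
          (ρ * ∏ i ∈ univ.filter (fun i => W.b t i ≠ 0), W.b t i ^ ((S.erase (W.j t)) i)) := by
  classical
  have hgne : (ifp W t).gen J₀ ≠ 0 := by
    intro h0; rw [h0, ordZero_zero] at hd₀; exact ENat.top_ne_coe _ hd₀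
  have ha : p ^ e - J₀.degree ≤ S.degree := by
    have := sing_ifp hp hs W t J₀ hJ₀ hgne
    rw [hd₀] at this; exact_mod_cast this
  have hcarry := carry_monomial_of_clean (W.b t) (W.onExc t) ha hd₀ S hρ hG (hcl J₀ hJ₀ hμ _ hd₀)
  have hgen : (ifp W (t + 1)).gen J₀ =
      PointBlowup.translate (W.b t) (chartTransform (p ^ e - J₀.degree) (W.j t) ((ifp W t).gen J₀)) := by
    rw [ifp_succ]; rfl
  have hrig := stall_rigid (p ^ e) (W.j t) (W.b t) (W.onExc t) (ifp W t) (fun J hJ => (level_bounds W t J hJ).2)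
    (sing_ifp hp hs W t) (by rw [← ifp_succ]; exact hst.symm.le) hJ₀ hμ hd₀
  refine ⟨by rw [idx_ifp] at hJ₀ ⊢; exact hJ₀, by rw [ifp_succ]; exact hrig.2.2.1, ha, ?_, ?_⟩
  · rw [hgen, hcarry.1]
  · rw [hgen, hcarry.2]

end Walk

end Summit.ResolutionOfSingularities.ResolutionOfSingularities.Theorems.StallVertex
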